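import Summits.QuantumFields.BalabanUV.Beta.GAN24.ContactCellBounds

/-!
# `BalabanUV.Beta.GAN24.ContactAssembly` — binder row G-an2-4 / (CONV-C), the row owner's CONTACT-TERM ROUTE, **CT-3c END** (`gen19/CT3-MECHANISM-v1.2.md` §B,
# the owner's worded shape): THE CONTACT TERM OF THE DRESSED CUBIC WILSON PUSH IS MAIN ORDER, `k`-UNIFORMLY —
# `|push₃ T T T (wilsonA 3) κ′ u′ x′ z′ (inl α) (inl β) − push₃ B B B (wilsonA 3) κ′ u′ x′ z′ (inl α) (inl β)| ≤ K·(Lc^{12(k+1)})⁻¹·e^{−κ′(‖x′−u′‖∞ + ‖z′−u′‖∞)}`,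
# `T = legChain (respStepBmSeq (toSite rr) Lc) 0 k`, `B = respStep 1 (Lc^(k+1))`, for every in-block root, EVERY `k` and every coarse data, from `2 ≤ Lc` ALONE.

NOT IN PRINT; OUR PROOF (G-an2-4 formalisation swarm, leaf prover `b2b-balaban-gan24-formalise-leaf-01`, gen 58; CT-3c under «MINE» l.31499 ∕ 31626 ∕ 31667 ∕ 31740;
the owner gan24-p1-g19's GO and END shape `CT3-MECHANISM-v1.2.md` §A∕§B, journal l.31770; choice (b) l.31846).  HONEST FRAMING (cell contract, verbatim): «discharging
`BetaPertH` makes Bałaban's UV stability UNCONDITIONAL — a real constructive-QFT result; it is NOT the continuum limit and NOT the Clay problem.»  HONEST DEPENDENCY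
(verbatim): «continuum YM on T⁴ ⇐ BetaPertH ∧ nine spine estimates (0/9 proved); BetaPertH ⇐ (D1) ∧ (D4) ∧ CAP+tail; G-an2-4 gates asym, D1 and NE2/3/4.»

WHAT.
* §1 **`exists_common_letters`** (`d = 3`, `2 ≤ Lc`): ONE rate `κ₀ > 0` and constants `C, KE, Φ₀ ≥ 0` carrying leaf-12's (N1) (every base `m`), leaf-01 g57's dressed envelope
  (every in-block root), d4-p3's I1 translated to the source block, and the translated tent bound — the four letter families `ContactCellBounds` is parametric in.
* §2 bookkeeping: the spread exchange `exp(−(κ₀∕12)·S_p) ≤ exp(−(κ₀∕24)·S_{u′})` for the three base points, and the two power identities that turn the cells' letter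
  products into `K·(Lc^{12(k+1)})⁻¹` (main order: `N^{−4}·N^{−5}·N^{−7}·N^{4} = N^{−12}`; the pairing's `Lc^k` against `N = Lc·Lc^k` exactly).
* §3 **`exists_contact_bound`** — THE END, in the owner's worded shape; **`contact_locStencil`**-type corollaries are the (E-α-W) ∕ units steps' business (leaf-03 g52's
  `SrecWilsonSector`, the S3 road), not restated here.
DEPENDENCY LEDGER of the END (all TREE or filed with it, kernel-checked, [folklore]-grade bookkeeping ∕ real analysis on the cell's typed `U = 1` objects):
`ContactKernelCells` (CONTACT = three cells: `Push3LegTelescope`, `Push3GaugeSlotCells`, leaf-02's CT-1∕CT-3a), `ContactCellBounds` ← `ContactCellReduction` (leaf-02's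
`cell_eq'` ∕ three-envelope bound, `ContactCellSplit`) + the owner's `StaircasePairing` and leaf-03's `StaircasePairingReadings` (dressed partners' gauge parts) +
`ContactGaugeStaircase` (per-scale envelopes from my g57 `DressedLegEnvelope`) + `ContactPartnerLetters` (an5's `wH_EL'`, d4-p3's I1∕I2, leaf-12's (N1), leaf-03's §10).
NO cited fact, NO `def … : Prop`, 0 sorry; constants existential (K is a displayed polynomial in C, Φ₀, Lc, e^{κ₀}, Zl inside the proof).  Discharges NOTHING of (hS,
hSall) BY ITSELF: hS0 for (E) ⟸ this END + (E-α-W) + road S3's undressed rows + units (owner's v1.2 §D); 0 wall binders; NEVER «G-an2-4 closed» as (CONV-C); NOT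
D1, NOT BetaPertH, NOT continuum, NOT Clay.
-/

noncomputable section

open Finset
open scoped BigOperators
open Literature.MathematicalPhysics.QuantumFieldTheory
open Literature.MathematicalPhysics.QuantumFieldTheory.LatticeForm (quo)
open Literature.MathematicalPhysics.QuantumFieldTheory.Balaban1983to89
open Literature.MathematicalPhysics.QuantumFieldTheory.Balaban1983to89.Beta
open B4ContourShift (supNorm supNorm_nonneg abs_le_supNorm)
open B4Reflection242 (supNorm_le_of_forall supNorm_add_le)
open ExpKernelCalculus (Zl Zl_nonneg)
open StepJetData (wilsonA)
open AffineAveraging (Form0 Form1 Site box toSite curv curvAdj)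
open AffineReproduction (contourSumAdj)
open KernelSpecInstance (wΦ)
open B6BondElimination (unitVec)
open KKTFluctuationKernel (delta1)
open BalabanCompositeJets (respStep)
open Summit.QuantumFields.BalabanUV.Beta.AxialProjectorBlockMean (bmGaugeAt)
open Summit.QuantumFields.BalabanUV.Beta.GAN24.Push4Iter (LegFam legChain)
open Summit.QuantumFields.BalabanUV.Beta.GAN24.RespStepBmDecompExact (respStepBmSeq)
open Summit.QuantumFields.BalabanUV.Beta.GAN24.RespStepBmDecompPsi (Psi)
open Summit.QuantumFields.BalabanUV.Beta.GAN24.RespStepDecay (exists_respStep_decay_and_grad)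
open Summit.QuantumFields.BalabanUV.Beta.GAN24.UndressedResponseUnits (inv_cast_pow_pow)
open Summit.QuantumFields.BalabanUV.Beta.GAN24.DressedLegEnvelope (exists_legChain_envelope)
open Summit.QuantumFields.BalabanUV.Beta.RemainderExplicitMultiplier (exists_wΦ_decay)
open Summit.QuantumFields.BalabanUV.Beta.RemainderExplicitLaplacian (abs_contourSumAdj_le)
open Summit.QuantumFields.BalabanUV.Beta.GAN24.Push3 (push₃)
open Summit.QuantumFields.BalabanUV.Beta.GAN24.ContactKernelCells (contact_legChain_ff_eq_cells)
open Summit.QuantumFields.BalabanUV.Beta.GAN24.ContactPartnerLetters (contourSumAdj_sub_zsmul quo_sub_zsmul' respStep_pow_zero)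
open Summit.QuantumFields.BalabanUV.Beta.GAN24.ContactCellBounds (abs_cellL_bound abs_cellR_bound abs_cellW_bound)

namespace Summit.QuantumFields.BalabanUV.Beta.GAN24.ContactAssembly

variable {Lc : ℕ} [NeZero Lc]

/-! ## §1 The four letter families at one common rate -/

/-- NOT IN PRINT; OUR BOOKKEEPING.  **THE LETTERS OF CT-3c AT ONE RATE** (`d = 3`, `2 ≤ Lc`): `∃ κ₀ > 0, C KE Φ₀ ≥ 0` with (a) leaf-12's (N1) for the undressed composite
response at EVERY base `m`, (b) leaf-01 g57's envelope of the dressed composite legs at base `0` for every in-block root, (c) d4-p3's I1 translated to the source block,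
(d) the translated tent bound — all at the rate `κ₀` (the minimum of the suppliers'; envelopes are monotone in the rate). -/
theorem exists_common_letters (hLc : 2 ≤ Lc) :
    ∃ κ₀ C KE Φ₀ : ℝ, 0 < κ₀ ∧ 0 ≤ C ∧ 0 ≤ KE ∧ 0 ≤ Φ₀ ∧
      (∀ (m k : ℕ) (μ : Fin (3 + 1)) (z : Site (3 + 1)) (l'' : Fin (3 + 1)) (w' : Site (3 + 1)),
        |respStep (d := 3) (Lc ^ m) (Lc ^ (m + k + 1)) μ z l'' w'| ≤
          C * ((Lc : ℝ) ^ (5 * (k + 1)))⁻¹ * Real.exp (-(κ₀ * supNorm (quo (Lc ^ (k + 1)) w' - z)))) ∧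
      (∀ (rr : Fin (3 + 1) → ℕ), rr ∈ box (3 + 1) Lc → ∀ (k : ℕ) (μ : Fin (3 + 1)) (z : Site (3 + 1)) (κ : Fin (3 + 1)) (u : Site (3 + 1)),
        |legChain (respStepBmSeq (d := 3) (toSite rr) Lc) 0 k μ z κ u|
          ≤ KE * ((Lc : ℝ) ^ (4 * (k + 1)))⁻¹ * Real.exp (-(κ₀ * supNorm (quo (Lc ^ (k + 1)) u - z)))) ∧
      (∀ (k : ℕ) (μ : Fin (3 + 1)) (z : Site (3 + 1)) (κ : Fin (3 + 1)) (y : Site (3 + 1)),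
        |wΦ (N := Lc ^ (k + 1)) κ μ (y - z)| ≤ Φ₀ * ((Lc : ℝ) ^ (8 * (k + 1)))⁻¹ * Real.exp (-(κ₀ * supNorm (y - z)))) ∧
      (∀ (k : ℕ) (μ : Fin (3 + 1)) (z : Site (3 + 1)) (κ : Fin (3 + 1)) (u : Site (3 + 1)),
        |contourSumAdj (Lc ^ (k + 1)) (fun κ y => wΦ (N := Lc ^ (k + 1)) κ μ (y - z)) κ u|
          ≤ (Lc ^ (k + 1) : ℕ) * (Φ₀ * ((Lc : ℝ) ^ (8 * (k + 1)))⁻¹) * Real.exp κ₀ *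
            Real.exp (-(κ₀ * supNorm (quo (Lc ^ (k + 1)) u - z)))) := by
  obtain ⟨κ₁, C, -, hκ₁, hC, -, hN1, -⟩ := exists_respStep_decay_and_grad (Lc := Lc)
  obtain ⟨κ₂, KE, hκ₂, hKE, hE⟩ := exists_legChain_envelope (Lc := Lc) hLc
  obtain ⟨κ₃, Φ, hκ₃, hΦ, hI1⟩ := exists_wΦ_decay (Lc := Lc)
  set κ₀ : ℝ := min κ₁ (min κ₂ κ₃) with hκ₀
  have h01 : κ₀ ≤ κ₁ := min_le_left _ _
  have h02 : κ₀ ≤ κ₂ := (min_le_right _ _).trans (min_le_left _ _)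
  have h03 : κ₀ ≤ κ₃ := (min_le_right _ _).trans (min_le_right _ _)
  have hκ₀pos : 0 < κ₀ := lt_min hκ₁ (lt_min hκ₂ hκ₃)
  have mono : ∀ {κ κ' : ℝ} (s : ℝ), κ ≤ κ' → 0 ≤ s → Real.exp (-(κ' * s)) ≤ Real.exp (-(κ * s)) :=
    fun s h hs => Real.exp_le_exp.2 (by nlinarith)
  have hΦenv : ∀ (k : ℕ) (μ : Fin (3 + 1)) (z : Site (3 + 1)) (κ : Fin (3 + 1)) (y : Site (3 + 1)),
      |wΦ (N := Lc ^ (k + 1)) κ μ (y - z)| ≤ Φ * ((Lc : ℝ) ^ (8 * (k + 1)))⁻¹ * Real.exp (-(κ₀ * supNorm (y - z))) := by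
    intro k μ z κ y
    have h := hI1 k κ μ (y - z)
    rw [inv_cast_pow_pow, inv_cast_pow_pow] at h
    calc |wΦ (N := Lc ^ (k + 1)) κ μ (y - z)|
        ≤ Φ * ((Lc : ℝ) ^ (5 * (k + 1)))⁻¹ * ((Lc : ℝ) ^ (3 * (k + 1)))⁻¹ * Real.exp (-(κ₃ * supNorm (y - z))) := h
      _ = Φ * ((Lc : ℝ) ^ (8 * (k + 1)))⁻¹ * Real.exp (-(κ₃ * supNorm (y - z))) := by
          rw [show 8 * (k + 1) = 5 * (k + 1) + 3 * (k + 1) by ring, pow_add, mul_inv]; ring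
      _ ≤ Φ * ((Lc : ℝ) ^ (8 * (k + 1)))⁻¹ * Real.exp (-(κ₀ * supNorm (y - z))) :=
          mul_le_mul_of_nonneg_left (mono _ h03 (supNorm_nonneg _)) (by positivity)
  refine ⟨κ₀, C, KE, Φ, hκ₀pos, hC, hKE, hΦ, fun m k μ z l'' w' => ?_, fun rr hrr k μ z κ u => ?_, hΦenv, fun k μ z κ u => ?_⟩
  · have h := hN1 m k μ z l'' w'
    rw [inv_cast_pow_pow] at h
    exact h.trans (mul_le_mul_of_nonneg_left (mono _ h01 (supNorm_nonneg _)) (by positivity))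
  · exact (hE rr hrr 0 k μ z κ u).trans (mul_le_mul_of_nonneg_left (mono _ h02 (supNorm_nonneg _)) (by positivity))
  · haveI : NeZero (Lc ^ (k + 1)) := ⟨pow_ne_zero _ (NeZero.ne Lc)⟩
    have hNpos : 0 < Lc ^ (k + 1) := pow_pos (Nat.pos_of_ne_zero (NeZero.ne Lc)) _
    have h := abs_contourSumAdj_le (d := 3) hNpos (φ := fun κ' y => wΦ (N := Lc ^ (k + 1)) κ' μ (y + z - z))
      (B := Φ * ((Lc : ℝ) ^ (8 * (k + 1)))⁻¹) (κ₀ := κ₀) (by positivity) hκ₀pos.le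
      (fun κ' y => by have h' := hΦenv k μ z κ' (y + z); simp only [add_sub_cancel_right] at h' ⊢; exact h')
      κ (u - ((Lc ^ (k + 1) : ℕ) : ℤ) • z)
    rw [contourSumAdj_sub_zsmul, quo_sub_zsmul'] at h
    have e : (fun κ' y => (fun κ' y => wΦ (N := Lc ^ (k + 1)) κ' μ (y + z - z)) κ' (y - z))
        = fun κ' y => wΦ (N := Lc ^ (k + 1)) κ' μ (y - z) := by
      funext κ' y; simp only [sub_add_cancel]
    rw [e] at h
    exact h

/-! ## §2 Bookkeeping: spreads and powers -/

/-- [folklore] `‖x − y‖∞ = ‖y − x‖∞`. -/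
theorem supNorm_sub_comm (x y : Site (3 + 1)) : supNorm (x - y) = supNorm (y - x) := by
  have key : ∀ a b : Site (3 + 1), supNorm (a - b) ≤ supNorm (b - a) := fun a b =>
    supNorm_le_of_forall fun i => by
      have h := abs_le_supNorm (b - a) i
      have e : |(a - b) i| = |(b - a) i| := by rw [Pi.sub_apply, Pi.sub_apply, abs_sub_comm]
      rw [e]; exact h
  exact le_antisymm (key x y) (key y x)

/-- [folklore] **SPREAD EXCHANGE**: moving the base point of a two-distance spread costs a factor `2`:
`‖p − q‖ + ‖r − q‖ ≤ 2·(‖q − p‖ + ‖r − p‖)` (sup norms on `ℤ⁴`). -/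
theorem spread_rebase (p q r : Site (3 + 1)) : supNorm (p - q) + supNorm (r - q) ≤ 2 * (supNorm (q - p) + supNorm (r - p)) := by
  have h1 : supNorm (p - q) = supNorm (q - p) := supNorm_sub_comm p q
  have h2 : supNorm (r - q) ≤ supNorm (r - p) + supNorm (p - q) := by
    have e : r - q = (r - p) + (p - q) := by abel
    rw [e]; exact supNorm_add_le _ _
  have h3 := supNorm_nonneg (r - p)
  linarith

/-- [folklore] The exponential form of the spread exchange: `e^{−(κ₀∕12)(‖q−p‖+‖r−p‖)} ≤ e^{−(κ₀∕24)(‖p−q‖+‖r−q‖)}` (`κ₀ ≥ 0`). -/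
theorem exp_spread_rebase {κ₀ : ℝ} (hκ : 0 ≤ κ₀) (p q r : Site (3 + 1)) :
    Real.exp (-(κ₀ / 12) * (supNorm (q - p) + supNorm (r - p))) ≤ Real.exp (-(κ₀ / 24) * (supNorm (p - q) + supNorm (r - q))) := by
  rw [Real.exp_le_exp]
  have h := spread_rebase p q r
  nlinarith [supNorm_nonneg (q - p), supNorm_nonneg (r - p)]

/-- [folklore] The same base point, half the rate: `e^{−(κ₀∕12)S} ≤ e^{−(κ₀∕24)S}`. -/
theorem exp_spread_half {κ₀ : ℝ} (hκ : 0 ≤ κ₀) (q p r : Site (3 + 1)) :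
    Real.exp (-(κ₀ / 12) * (supNorm (q - p) + supNorm (r - p))) ≤ Real.exp (-(κ₀ / 24) * (supNorm (q - p) + supNorm (r - p))) := by
  rw [Real.exp_le_exp]
  nlinarith [supNorm_nonneg (q - p), supNorm_nonneg (r - p)]

/-- [folklore] **THE THREE-ENVELOPE POWER IDENTITY** (main order): with `N = Lc^(k+1)`,
`½·4·(2·(8LcC·N⁻⁵)·Lc^k·e^{κ₀})·(C N⁻⁵·(N·Φ₀N⁻⁸·e^{κ₀}) + C N⁻⁵·(N·Φ₀N⁻⁸·e^{κ₀}))·N⁴ = (64·C²·Φ₀·e^{κ₀}·e^{κ₀})·(Lc^{12(k+1)})⁻¹` (`Lc·Lc^k = N`). -/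
theorem coeff_env3_eq (C Φ₀ κ₀ : ℝ) (k : ℕ) :
    (1 / 2 : ℝ) * ((((3 : ℕ) : ℝ) + 1) * ((2 * (8 * (Lc : ℝ) * C * ((Lc : ℝ) ^ (5 * (k + 1)))⁻¹) * (Lc : ℝ) ^ k) * Real.exp κ₀) *
          ((C * ((Lc : ℝ) ^ (5 * (k + 1)))⁻¹) * ((Lc ^ (k + 1) : ℕ) * (Φ₀ * ((Lc : ℝ) ^ (8 * (k + 1)))⁻¹) * Real.exp κ₀)
            + (C * ((Lc : ℝ) ^ (5 * (k + 1)))⁻¹) * ((Lc ^ (k + 1) : ℕ) * (Φ₀ * ((Lc : ℝ) ^ (8 * (k + 1)))⁻¹) * Real.exp κ₀))) *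
        (((Lc ^ (k + 1) : ℕ) : ℝ)) ^ (3 + 1)
      = (64 * C ^ 2 * Φ₀ * Real.exp κ₀ * Real.exp κ₀) * ((Lc : ℝ) ^ (12 * (k + 1)))⁻¹ := by
  have hL0 : (Lc : ℝ) ≠ 0 := by exact_mod_cast NeZero.ne Lc
  have hx : (((Lc ^ (k + 1) : ℕ) : ℝ)) = (Lc : ℝ) * (Lc : ℝ) ^ k := by push_cast; ring
  have e5 : (Lc : ℝ) ^ (5 * (k + 1)) = ((Lc : ℝ) * (Lc : ℝ) ^ k) ^ 5 := by rw [← pow_succ', ← pow_mul']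
  have e8 : (Lc : ℝ) ^ (8 * (k + 1)) = ((Lc : ℝ) * (Lc : ℝ) ^ k) ^ 8 := by rw [← pow_succ', ← pow_mul']
  have e12 : (Lc : ℝ) ^ (12 * (k + 1)) = ((Lc : ℝ) * (Lc : ℝ) ^ k) ^ 12 := by rw [← pow_succ', ← pow_mul']
  have hy : (Lc : ℝ) ^ k ≠ 0 := pow_ne_zero _ hL0
  rw [hx, e5, e8, e12]
  push_cast
  field_simp
  ring

/-- [folklore] **THE PAIRING POWER IDENTITY** (main order, the scale sum's `Lc^k` against `N = Lc·Lc^k`):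
`½·4·(8e^{5κ₀}·α₀²·Lc^k·(2τ + Φ₀′Lc^k))·N⁴ = (1024·e^{5κ₀}·C²·Φ₀·(2·Lc·e^{κ₀} + 1))·(Lc^{12(k+1)})⁻¹`. -/
theorem coeff_pair_eq (C Φ₀ κ₀ : ℝ) (k : ℕ) :
    (1 / 2 : ℝ) * ((((3 : ℕ) : ℝ) + 1) *
        ((8 * Real.exp (5 * κ₀) * (8 * (Lc : ℝ) * C * ((Lc : ℝ) ^ (5 * (k + 1)))⁻¹) * (8 * (Lc : ℝ) * C * ((Lc : ℝ) ^ (5 * (k + 1)))⁻¹) *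
            (Lc : ℝ) ^ k * (2 * ((Lc ^ (k + 1) : ℕ) * (Φ₀ * ((Lc : ℝ) ^ (8 * (k + 1)))⁻¹) * Real.exp κ₀)
              + (Φ₀ * ((Lc : ℝ) ^ (8 * (k + 1)))⁻¹) * (Lc : ℝ) ^ k)) * (((Lc ^ (k + 1) : ℕ) : ℝ)) ^ (3 + 1)))
      = (1024 * Real.exp (5 * κ₀) * C ^ 2 * Φ₀ * (2 * (Lc : ℝ) * Real.exp κ₀ + 1)) * ((Lc : ℝ) ^ (12 * (k + 1)))⁻¹ := by
  have hL0 : (Lc : ℝ) ≠ 0 := by exact_mod_cast NeZero.ne Lc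
  have hx : (((Lc ^ (k + 1) : ℕ) : ℝ)) = (Lc : ℝ) * (Lc : ℝ) ^ k := by push_cast; ring
  have e5 : (Lc : ℝ) ^ (5 * (k + 1)) = ((Lc : ℝ) * (Lc : ℝ) ^ k) ^ 5 := by rw [← pow_succ', ← pow_mul']
  have e8 : (Lc : ℝ) ^ (8 * (k + 1)) = ((Lc : ℝ) * (Lc : ℝ) ^ k) ^ 8 := by rw [← pow_succ', ← pow_mul']
  have e12 : (Lc : ℝ) ^ (12 * (k + 1)) = ((Lc : ℝ) * (Lc : ℝ) ^ k) ^ 12 := by rw [← pow_succ', ← pow_mul']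
  have hy : (Lc : ℝ) ^ k ≠ 0 := pow_ne_zero _ hL0
  rw [hx, e5, e8, e12]
  push_cast
  field_simp
  ring

/-! ## §3 THE END -/

/-- NOT IN PRINT; OUR PROOF.  **CT-3c END — THE CONTACT TERM OF THE CONTACT-TERM ROUTE IS MAIN ORDER, `k`-UNIFORMLY** (`d = 3`; the owner's worded shape,
`CT3-MECHANISM-v1.2.md` §B): from `2 ≤ Lc` ALONE, `∃ κ′ > 0, K ≥ 0` such that for EVERY in-block root `rr ∈ box 4 Lc`, EVERY number of levels `k`, and every coarse
data `κ′ u′ x′ z′ α β`,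
`|push₃ T T T (wilsonA 3) κ′ u′ x′ z′ (inl α) (inl β) − push₃ B B B (wilsonA 3) κ′ u′ x′ z′ (inl α) (inl β)| ≤ K·(Lc^{12(k+1)})⁻¹·e^{−κ′(‖x′ − u′‖∞ + ‖z′ − u′‖∞)}`,
`T = legChain (respStepBmSeq (toSite rr) Lc) 0 k` (the dressed composite legs from the source level `k+1` to the vertex level `0`), `B = respStep 1 (Lc^(k+1))` (the
undressed one-shot legs) — the size `N^{−2D−4}` of the undressed cubic table entry itself («block-scale entries move by O(1) in units»).  `κ′ = κ₀∕24`, `K` a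
displayed polynomial in the letters. -/
theorem exists_contact_bound (hLc : 2 ≤ Lc) :
    ∃ κ' K : ℝ, 0 < κ' ∧ 0 ≤ K ∧ ∀ (rr : Fin (3 + 1) → ℕ), rr ∈ box (3 + 1) Lc →
      ∀ (k : ℕ) (κ₁ : Fin (3 + 1)) (u' x' z' : Site (3 + 1)) (α β : Fin (3 + 1)),
        |push₃ (legChain (respStepBmSeq (d := 3) (toSite rr) Lc) 0 k) (legChain (respStepBmSeq (d := 3) (toSite rr) Lc) 0 k)
            (legChain (respStepBmSeq (d := 3) (toSite rr) Lc) 0 k) (wilsonA 3) κ₁ u' x' z' (Sum.inl α) (Sum.inl β)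
          - push₃ (respStep (d := 3) 1 (Lc ^ (k + 1))) (respStep (d := 3) 1 (Lc ^ (k + 1))) (respStep (d := 3) 1 (Lc ^ (k + 1)))
            (wilsonA 3) κ₁ u' x' z' (Sum.inl α) (Sum.inl β)|
          ≤ K * ((Lc : ℝ) ^ (12 * (k + 1)))⁻¹ * Real.exp (-(κ' * (supNorm (x' - u') + supNorm (z' - u')))) := by
  obtain ⟨κ₀, C, KE, Φ₀, hκ, hC, hKE, hΦ, hN1, hE, hΦenv, ht⟩ := exists_common_letters (Lc := Lc) hLc
  set Z : ℝ := Zl (3 + 1) (κ₀ / (4 * (((3 : ℕ) : ℝ) + 1))) with hZ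
  have hZ0 : 0 ≤ Z := Zl_nonneg (by positivity)
  set K3 : ℝ := 64 * C ^ 2 * Φ₀ * Real.exp κ₀ * Real.exp κ₀ with hK3
  set KP : ℝ := 1024 * Real.exp (5 * κ₀) * C ^ 2 * Φ₀ * (2 * (Lc : ℝ) * Real.exp κ₀ + 1) with hKP
  have hK30 : 0 ≤ K3 := by positivity
  have hKP0 : 0 ≤ KP := by positivity
  refine ⟨κ₀ / 24, (3 * K3 + 3 * KP) * Z, by positivity, by positivity, fun rr hrr k κ₁ u' x' z' α β => ?_⟩
  -- the three cells
  rw [← respStep_pow_zero (Lc := Lc) k, contact_legChain_ff_eq_cells hLc hrr 0 k κ₁ u' x' z' α β]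
  have hL := abs_cellL_bound hLc hrr hκ hC hΦ hN1 (hE rr hrr) hΦenv ht k κ₁ u' x' z' α β
  have hR := abs_cellR_bound hLc hrr hκ hC hΦ hN1 hΦenv ht k κ₁ u' x' z' α β
  have hW := abs_cellW_bound hLc hrr hκ hC hΦ hN1 ht k κ₁ u' x' z' α β
  -- the two power identities
  have c3 := coeff_env3_eq (Lc := Lc) C Φ₀ κ₀ k
  have cp := coeff_pair_eq (Lc := Lc) C Φ₀ κ₀ k
  -- names for the recurring blocks (abstracted simultaneously in `hL hR hW c3 cp` and the goal)
  set X : ℝ := ((Lc : ℝ) ^ (12 * (k + 1)))⁻¹ with hX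
  set E' : ℝ := Real.exp (-(κ₀ / 24 * (supNorm (x' - u') + supNorm (z' - u')))) with hE'
  set c₁ : ℝ := (1 / 2 : ℝ) * ((((3 : ℕ) : ℝ) + 1) * ((2 * (8 * (Lc : ℝ) * C * ((Lc : ℝ) ^ (5 * (k + 1)))⁻¹) * (Lc : ℝ) ^ k) * Real.exp κ₀) *
      ((C * ((Lc : ℝ) ^ (5 * (k + 1)))⁻¹) * ((Lc ^ (k + 1) : ℕ) * (Φ₀ * ((Lc : ℝ) ^ (8 * (k + 1)))⁻¹) * Real.exp κ₀)
        + (C * ((Lc : ℝ) ^ (5 * (k + 1)))⁻¹) * ((Lc ^ (k + 1) : ℕ) * (Φ₀ * ((Lc : ℝ) ^ (8 * (k + 1)))⁻¹) * Real.exp κ₀))) with hc₁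
  set P : ℝ := 8 * Real.exp (5 * κ₀) * (8 * (Lc : ℝ) * C * ((Lc : ℝ) ^ (5 * (k + 1)))⁻¹) * (8 * (Lc : ℝ) * C * ((Lc : ℝ) ^ (5 * (k + 1)))⁻¹) *
      (Lc : ℝ) ^ k * (2 * ((Lc ^ (k + 1) : ℕ) * (Φ₀ * ((Lc : ℝ) ^ (8 * (k + 1)))⁻¹) * Real.exp κ₀)
        + (Φ₀ * ((Lc : ℝ) ^ (8 * (k + 1)))⁻¹) * (Lc : ℝ) ^ k) with hP
  set N4 : ℝ := (((Lc ^ (k + 1) : ℕ) : ℝ)) ^ (3 + 1) with hN4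
  set E₁ : ℝ := Real.exp (-(κ₀ / 12) * (supNorm (u' - x') + supNorm (z' - x'))) with hE₁
  set E₂ : ℝ := Real.exp (-(κ₀ / 12) * (supNorm (x' - z') + supNorm (u' - z'))) with hE₂
  set E₃ : ℝ := Real.exp (-(κ₀ / 12) * (supNorm (x' - u') + supNorm (z' - u'))) with hE₃
  set E₄ : ℝ := Real.exp (-(κ₀ / 12) * (supNorm (u' - z') + supNorm (x' - z'))) with hE₄
  set E₅ : ℝ := Real.exp (-(κ₀ / 12) * (supNorm (z' - x') + supNorm (u' - x'))) with hE₅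
  have hX0 : 0 ≤ X := by positivity
  -- the five exponentials against the target one
  have hmul : ∀ s : ℝ, -(κ₀ / 24) * s = -(κ₀ / 24 * s) := fun s => by ring
  have ex1 : E₁ ≤ E' := by rw [hE', hE₁, ← hmul]; exact exp_spread_rebase hκ.le x' u' z'
  have ex2 : E₂ ≤ E' := by
    rw [hE', hE₂, ← hmul, add_comm (supNorm (x' - z')), add_comm (supNorm (x' - u'))]; exact exp_spread_rebase hκ.le z' u' x'
  have ex3 : E₃ ≤ E' := by rw [hE', hE₃, ← hmul]; exact exp_spread_half hκ.le x' u' z'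
  have ex4 : E₄ ≤ E' := by rw [hE', hE₄, ← hmul, add_comm (supNorm (x' - u'))]; exact exp_spread_rebase hκ.le z' u' x'
  have ex5 : E₅ ≤ E' := by rw [hE', hE₅, ← hmul, add_comm (supNorm (z' - x'))]; exact exp_spread_rebase hκ.le x' u' z'
  -- each piece against `K·X·Z·E'`
  have hK3XZ : 0 ≤ K3 * X * Z := mul_nonneg (mul_nonneg hK30 hX0) hZ0
  have hKPXZ : 0 ≤ KP * X * Z := mul_nonneg (mul_nonneg hKP0 hX0) hZ0
  have t3 : ∀ {E : ℝ}, E ≤ E' → c₁ * (N4 * Z * E) ≤ K3 * X * Z * E' := by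
    intro E hEE
    calc c₁ * (N4 * Z * E) = (K3 * X) * Z * E := by rw [← c3]; ring
      _ ≤ (K3 * X) * Z * E' := mul_le_mul_of_nonneg_left hEE hK3XZ
  have tP : ∀ {E : ℝ}, E ≤ E' → (1 / 2 : ℝ) * ((((3 : ℕ) : ℝ) + 1) * (P * (N4 * Z * E))) ≤ KP * X * Z * E' := by
    intro E hEE
    calc (1 / 2 : ℝ) * ((((3 : ℕ) : ℝ) + 1) * (P * (N4 * Z * E))) = (KP * X) * Z * E := by rw [← cp]; ring
      _ ≤ (KP * X) * Z * E' := mul_le_mul_of_nonneg_left hEE hKPXZ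
  have bL := hL.trans (add_le_add (add_le_add (t3 ex1) (tP ex2)) (tP ex3))
  have bR := hR.trans (add_le_add (t3 ex4) (tP ex5))
  have bW := hW.trans (t3 ex3)
  -- sum
  have habs := (abs_add_le _ _).trans (add_le_add (abs_sub _ _) bW) |>.trans (add_le_add (add_le_add bL bR) le_rfl)
  refine habs.trans (le_of_eq ?_)
  ring

end Summit.QuantumFields.BalabanUV.Beta.GAN24.ContactAssembly

end
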